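import Summits.QuantumFields.YangMills.Theorems.Instrument.TorusLevelCount
import Literature.Combinatorics.SimpleGraph.RemovableArc
import HarnessLib

/-!
# Instrument cell `ym-instrument`, crew (b): ★ LEMMA W — the TORUS CENSUS IDENTITY of RADIUS-DERIVATION v0.6.2 (7.0): for an even torus `(ℤ/L)⁴`, `L ≥ 4`, a free link `f̃` of `ℤ⁴`
# and every `n ≤ 2L − 1`, the (G1) polymer counts agree: `freePolymerCountT L (torusEdge L f̃) n = freePolymerCount f̃ n`

QUESTIONS.md: Q-B2 (S2-SPEC v0.5.1 §0 reading (β-torus): the census HEAD of the reftable row is enumerated on `ℤ⁴` (eng-2 ∕ sc-ref) and used on the torus `L = 2S₀`; RADIUS-DERIVATION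
(7.0) LEMMA W (W1)–(W3), sc-ref's independent proof REFEREE §6.45); cell `run/shared/lean/pub/ym-instrument/`, HUMAN RULING D-0084 (2), director-ym R138.  HONEST FRAMING (page 1,
binding).  WHAT IS CERTIFIED HERE: PURE COMBINATORICS — with `Y ↦ ` «image under the covering map `πP L`» as the bijection: (§1) a valid `ℤ⁴` polymer (`n` plaquettes through `f̃`,
free-link-connected, free links `≥ 2`-covered) with `n ≤ 2L − 1` is mapped INJECTIVELY by `πP L` (else the key lemma `TorusLevelCount.exists_many_images` exhibits `2L` distinct images
inside an `n`-set), is injective on its LINKS as well (`injOn_links_of_validZ`, (W1′)), and its image is a valid torus polymer through `torusEdge L f̃` (`validT_image`); (§2) two valid `ℤ⁴` polymers with the same image coincide (the key lemma on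
their union, connected through the shared free root link); (§3) every valid torus polymer is such an image (lift free-link paths from the lift of a root plaquette inside the preimage;
the reachable set is free-2-covered and connected, hence injectively projected, hence finite of the right size); (§4) ★ `census_identity`: `Nat.card` equality of the two validity
subtypes = `freePolymerCountT L (torusEdge L f̃) n = freePolymerCount f̃ n` for `3 ≤ L`, `L` even, `f̃` free, `n + 1 ≤ 2L`.  CONSEQUENCE (RADIUS-DERIVATION (7.0)(a)): the `ℤ⁴` census
head (data, untyped) IS the torus head for every `S₀ ≥ 5`, `n ≤ 4S₀ − 1`.  NOT a statement about any gauge theory; the census VALUES are not typed; NOT summit-bearing.  Grade (T).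
-/

noncomputable section

open Finset
open Literature.MathematicalPhysics.QuantumLattice (ZdEdge ZdPlaquette plaquetteEdges torusEdge)
open Literature.MathematicalPhysics.QuantumFieldTheory.Balaban1983to89.StrongCouplingKPWindow (links)
open Literature.Probability.LatticeModels (Site)
open Summit.QuantumFields.YangMills.Theorems.Instrument.AdmissibleLinkComplexCount (IsAdmConnected)
open Summit.QuantumFields.YangMills.Theorems.Instrument.ClosedComplexExploration (atLink)
open Summit.QuantumFields.YangMills.Theorems.Instrument.ClosedComplexTailBound (AdmClosed)
open Summit.QuantumFields.YangMills.Theorems.Instrument.FreeLinkPolymerDefs (IsFreeLink freePolymerCount)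
open Literature.MathematicalPhysics.QuantumFieldTheory (torusSect torusEdge_torusSect)
open Literature.Combinatorics.SimpleGraph (reflTransGen_of_imp)
open Summit.QuantumFields.YangMills.Theorems.Instrument.AbstractPolymerKraft (IncidenceSystem)
open Summit.QuantumFields.YangMills.Theorems.Instrument.TorusPolymerKraft (TSite TEdge TPlaquette tEdges torusSystem IsFreeLinkT freePolymerCountT)
open Summit.QuantumFields.YangMills.Theorems.Instrument.TorusCovering (πS πP tEdges_πP torusEdge_mem_tEdges exists_lift_plaquette lift_unique isFreeLinkT_torusEdge_iff)
open Summit.QuantumFields.YangMills.Theorems.Instrument.TorusLevelCount (TwoCovered FAdj fAdj_symm fAdj_path_symm exists_many_images exists_many_images_of_links)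

namespace Summit.QuantumFields.YangMills.Theorems.Instrument.TorusCensusIdentity

variable {L : ℕ}

/-! ## §0 The two validity predicates -/

/-- A valid (G1) polymer of `ℤ⁴` of size `n` through `f` (the subtype counted by `freePolymerCount f n`). [folklore] -/
def ValidZ (f : ZdEdge 4) (n : ℕ) (X : Finset (ZdPlaquette 4)) : Prop :=
  X.card = n ∧ f ∈ links X ∧ IsAdmConnected IsFreeLink X ∧ AdmClosed IsFreeLink X

/-- A valid (G1) polymer of the torus of size `n` through `f` (the subtype counted by `freePolymerCountT L f n`). [folklore] -/
def ValidT (L : ℕ) [NeZero L] (f : TEdge L) (n : ℕ) (Y : Finset (TPlaquette L)) : Prop :=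
  Y.card = n ∧ f ∈ AbstractPolymerKraft.links (torusSystem L) Y ∧ AbstractPolymerKraft.IsAdmConnected (torusSystem L) IsFreeLinkT Y ∧
    AbstractPolymerKraft.AdmClosed (torusSystem L) IsFreeLinkT Y

/-- `freePolymerCount f n` counts `ValidZ f n`. [folklore] -/
theorem freePolymerCount_eq (f : ZdEdge 4) (n : ℕ) : freePolymerCount f n = Nat.card {X : Finset (ZdPlaquette 4) // ValidZ f n X} := rfl

/-- `freePolymerCountT L f n` counts `ValidT L f n`. [folklore] -/
theorem freePolymerCountT_eq [NeZero L] (f : TEdge L) (n : ℕ) : freePolymerCountT L f n = Nat.card {Y : Finset (TPlaquette L) // ValidT L f n Y} := rfl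

/-- The links of the torus system are `tEdges`. [folklore] -/
theorem torusSystem_edges [NeZero L] : (torusSystem L).edges = tEdges := rfl

/-! ## §1 A valid `ℤ⁴` polymer of size `≤ 2L − 1` is projected injectively; its image is a valid torus polymer -/

-- monotonicity of `ReflTransGen` in the relation is the tree's `Literature.Combinatorics.SimpleGraph.reflTransGen_of_imp`

/-- Closed-on-free-links ⟹ the free-2-covering property of `TorusLevelCount`. [folklore] -/
theorem twoCovered_of_admClosed {X : Finset (ZdPlaquette 4)} (h : AdmClosed IsFreeLink X) : TwoCovered (↑X : Set (ZdPlaquette 4)) := by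
  intro q hq l hl hfree
  have h2 : 2 ≤ (atLink X l).card := h l (mem_biUnion.2 ⟨q, hq, hl⟩) hfree
  obtain ⟨q', hq', hne⟩ := Finset.exists_mem_ne (lt_of_lt_of_le one_lt_two h2) q
  exact ⟨q', (mem_filter.1 hq').1, hne, (mem_filter.1 hq').2⟩

/-- Free-link-connectedness ⟹ free-link paths inside `↑X`. [folklore] -/
theorem path_of_isAdmConnected {X : Finset (ZdPlaquette 4)} (h : IsAdmConnected IsFreeLink X) {p q : ZdPlaquette 4} (hp : p ∈ X) (hq : q ∈ X) :
    Relation.ReflTransGen (FAdj (↑X : Set (ZdPlaquette 4))) p q :=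
  reflTransGen_of_imp (fun _ _ hab => ⟨hab.1, hab.2.1, hab.2.2⟩) (h p hp q hq)

/-- ★ A valid `ℤ⁴` polymer of size `n ≤ 2L − 1` is mapped injectively by the covering map (`L ≥ 3`). [folklore] -/
theorem injOn_of_validZ [NeZero L] (hL : 3 ≤ L) {f : ZdEdge 4} {n : ℕ} (hn : n + 1 ≤ 2 * L) {X : Finset (ZdPlaquette 4)} (hX : ValidZ f n X) :
    Set.InjOn (πP L) ↑X := by
  classical
  intro p hp p' hp' heq
  by_contra hne
  obtain ⟨S, hS, hcard⟩ := exists_many_images hL (twoCovered_of_admClosed hX.2.2.2) (path_of_isAdmConnected hX.2.2.1 hp hp') hne heq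
  have h1 : (S.image (πP L)).card ≤ (X.image (πP L)).card := card_le_card (image_subset_image fun s hs => hS hs)
  have h2 : (X.image (πP L)).card ≤ X.card := card_image_le
  rw [hX.1] at h2
  omega

/-- ★ (W1′) LINK-INJECTIVITY (RADIUS-DERIVATION v0.6.3 (7.0) (W1′), sc-ref 02:31:18Z remark (1)): the covering map is injective on the LINKS of a valid `ℤ⁴` polymer of size
`n ≤ 2L − 1` (`L ≥ 3`) — so the activity integrand of the polymer and of its torus image have literally the same free variables. [folklore] -/
theorem injOn_links_of_validZ [NeZero L] (hL : 3 ≤ L) {f : ZdEdge 4} {n : ℕ} (hn : n + 1 ≤ 2 * L) {X : Finset (ZdPlaquette 4)} (hX : ValidZ f n X) :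
    Set.InjOn (torusEdge L) (↑(links X) : Set (ZdEdge 4)) := by
  classical
  intro l hl l' hl' heq
  by_contra hne
  obtain ⟨p, hp, hlp⟩ := mem_biUnion.1 (mem_coe.1 hl)
  obtain ⟨p', hp', hlp'⟩ := mem_biUnion.1 (mem_coe.1 hl')
  obtain ⟨S, hS, hcard⟩ := exists_many_images_of_links hL (twoCovered_of_admClosed hX.2.2.2) (mem_coe.2 hp) (mem_coe.2 hp')
    (path_of_isAdmConnected hX.2.2.1 hp hp') hlp hlp' hne heq
  have h1 : (S.image (πP L)).card ≤ (X.image (πP L)).card := card_le_card (image_subset_image fun s hs => hS hs)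
  have h2 : (X.image (πP L)).card ≤ X.card := card_image_le
  rw [hX.1] at h2
  omega

/-- Paths project: a free-link path in `X` projects to a free-torus-link path in `X.image πP` (even `L`). [folklore] -/
theorem path_image [NeZero L] (hLe : Even L) {X : Finset (ZdPlaquette 4)} {p q : ZdPlaquette 4}
    (h : Relation.ReflTransGen (FAdj (↑X : Set (ZdPlaquette 4))) p q) :
    Relation.ReflTransGen (fun a b : TPlaquette L => a ∈ X.image (πP L) ∧ b ∈ X.image (πP L) ∧ ∃ e : TEdge L, IsFreeLinkT e ∧ e ∈ tEdges a ∧ e ∈ tEdges b)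
      (πP L p) (πP L q) := by
  classical
  induction h with
  | refl => exact Relation.ReflTransGen.refl
  | tail _ hbc ih =>
    obtain ⟨hb, hc, e, he, heb, hec⟩ := hbc
    refine ih.tail ⟨mem_image_of_mem _ hb, mem_image_of_mem _ hc, torusEdge L e, (isFreeLinkT_torusEdge_iff hLe e).2 he,
      torusEdge_mem_tEdges heb, torusEdge_mem_tEdges hec⟩

/-- ★ The image of a valid `ℤ⁴` polymer is a valid torus polymer through the projected root (`L ≥ 3` even, `n + 1 ≤ 2L`). [folklore] -/
theorem validT_image [NeZero L] (hL : 3 ≤ L) (hLe : Even L) {f : ZdEdge 4} {n : ℕ} (hn : n + 1 ≤ 2 * L) {X : Finset (ZdPlaquette 4)} (hX : ValidZ f n X) :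
    ValidT L (torusEdge L f) n (X.image (πP L)) := by
  classical
  have hinj := injOn_of_validZ hL hn hX
  obtain ⟨hcard, hroot, hconn, hclosed⟩ := hX
  refine ⟨?_, ?_, ?_, ?_⟩
  · rw [card_image_of_injOn hinj, hcard]
  · obtain ⟨p, hp, hfp⟩ := mem_biUnion.1 hroot
    exact mem_biUnion.2 ⟨πP L p, mem_image_of_mem _ hp, torusEdge_mem_tEdges hfp⟩
  · intro a ha b hb
    obtain ⟨p, hp, rfl⟩ := mem_image.1 ha
    obtain ⟨q, hq, rfl⟩ := mem_image.1 hb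
    exact path_image hLe (path_of_isAdmConnected hconn hp hq)
  · intro l hl hlfree
    obtain ⟨y, hy, hly⟩ := mem_biUnion.1 hl
    obtain ⟨p, hp, rfl⟩ := mem_image.1 hy
    rw [torusSystem_edges, tEdges_πP] at hly
    obtain ⟨e, hep, rfl⟩ := mem_image.1 hly
    have hefree : IsFreeLink e := (isFreeLinkT_torusEdge_iff hLe e).1 hlfree
    have h2 : 2 ≤ (atLink X e).card := hclosed e (mem_biUnion.2 ⟨p, hp, hep⟩) hefree
    obtain ⟨p', hp', hne⟩ := Finset.exists_mem_ne (lt_of_lt_of_le one_lt_two h2) p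
    have hp'X : p' ∈ X := (mem_filter.1 hp').1
    have hep' : e ∈ plaquetteEdges p' := (mem_filter.1 hp').2
    have hπne : πP L p' ≠ πP L p := fun h => hne (hinj hp'X hp h)
    refine Finset.one_lt_card.2 ⟨πP L p, ?_, πP L p', ?_, hπne.symm⟩
    · exact mem_filter.2 ⟨mem_image_of_mem _ hp, by rw [torusSystem_edges]; exact torusEdge_mem_tEdges hep⟩
    · exact mem_filter.2 ⟨mem_image_of_mem _ hp'X, by rw [torusSystem_edges]; exact torusEdge_mem_tEdges hep'⟩

/-! ## §2 Injectivity: two valid `ℤ⁴` polymers with the same image coincide -/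

/-- ★ Two valid `ℤ⁴` polymers through a FREE root with the same image under the covering map coincide (`L ≥ 3`, `n + 1 ≤ 2L`). [folklore] -/
theorem eq_of_image_eq [NeZero L] (hL : 3 ≤ L) {f : ZdEdge 4} (hf : IsFreeLink f) {n : ℕ} (hn : n + 1 ≤ 2 * L) {X₁ X₂ : Finset (ZdPlaquette 4)}
    (h₁ : ValidZ f n X₁) (h₂ : ValidZ f n X₂) (heq : X₁.image (πP L) = X₂.image (πP L)) : X₁ = X₂ := by
  classical
  by_contra hne
  set C := X₁ ∪ X₂ with hC
  -- `C` has more than `n` members but only `n` images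
  have hCcard : n + 1 ≤ C.card := by
    by_contra hlt
    have hle : C.card ≤ n := by omega
    have e1 : X₁ = C := eq_of_subset_of_card_le subset_union_left (by rw [h₁.1]; exact hle)
    have e2 : X₂ = C := eq_of_subset_of_card_le subset_union_right (by rw [h₂.1]; exact hle)
    exact hne (e1.trans e2.symm)
  have hCimg : C.image (πP L) = X₁.image (πP L) := by rw [hC, image_union, ← heq, union_idempotent]
  have hCimg_card : (C.image (πP L)).card = n := by rw [hCimg, card_image_of_injOn (injOn_of_validZ hL hn h₁), h₁.1]
  -- hence `πP` is not injective on `C`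
  have hnotinj : ¬ Set.InjOn (πP L) ↑C := fun hinj => by
    have := card_image_of_injOn hinj; omega
  have hex : ∃ p ∈ (↑C : Set (ZdPlaquette 4)), ∃ p' ∈ (↑C : Set (ZdPlaquette 4)), πP L p = πP L p' ∧ p ≠ p' := by
    by_contra h
    exact hnotinj fun p hp p' hp' heq => by by_contra hne; exact h ⟨p, hp, p', hp', heq, hne⟩
  obtain ⟨p, hp, p', hp', hπ, hpp'⟩ := hex
  -- `C` is free-2-covered and `p`, `p'` are joined inside `C` (through the root link, which is free)
  have h2C : TwoCovered (↑C : Set (ZdPlaquette 4)) := by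
    intro q hq l hl hfree
    rcases mem_union.1 (mem_coe.1 hq) with hq1 | hq2
    · obtain ⟨q', hq', hne', hl'⟩ := twoCovered_of_admClosed h₁.2.2.2 q hq1 l hl hfree
      exact ⟨q', mem_coe.2 (mem_union_left _ hq'), hne', hl'⟩
    · obtain ⟨q', hq', hne', hl'⟩ := twoCovered_of_admClosed h₂.2.2.2 q hq2 l hl hfree
      exact ⟨q', mem_coe.2 (mem_union_right _ hq'), hne', hl'⟩
  have mono1 : ∀ {a b}, Relation.ReflTransGen (FAdj (↑X₁ : Set (ZdPlaquette 4))) a b → Relation.ReflTransGen (FAdj (↑C : Set (ZdPlaquette 4))) a b :=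
    fun h => reflTransGen_of_imp (fun _ _ hab => ⟨mem_union_left _ hab.1, mem_union_left _ hab.2.1, hab.2.2⟩) h
  have mono2 : ∀ {a b}, Relation.ReflTransGen (FAdj (↑X₂ : Set (ZdPlaquette 4))) a b → Relation.ReflTransGen (FAdj (↑C : Set (ZdPlaquette 4))) a b :=
    fun h => reflTransGen_of_imp (fun _ _ hab => ⟨mem_union_right _ hab.1, mem_union_right _ hab.2.1, hab.2.2⟩) h
  obtain ⟨r₁, hr₁, hfr₁⟩ := mem_biUnion.1 h₁.2.1
  obtain ⟨r₂, hr₂, hfr₂⟩ := mem_biUnion.1 h₂.2.1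
  have hbridge : Relation.ReflTransGen (FAdj (↑C : Set (ZdPlaquette 4))) r₁ r₂ :=
    Relation.ReflTransGen.single ⟨mem_union_left _ hr₁, mem_union_right _ hr₂, f, hf, hfr₁, hfr₂⟩
  -- a path inside `C` from any member to `r₁`
  have toRoot : ∀ {q}, q ∈ C → Relation.ReflTransGen (FAdj (↑C : Set (ZdPlaquette 4))) q r₁ := by
    intro q hq
    rcases mem_union.1 hq with hq1 | hq2
    · exact mono1 (path_of_isAdmConnected h₁.2.2.1 hq1 hr₁)
    · exact (mono2 (path_of_isAdmConnected h₂.2.2.1 hq2 hr₂)).trans (fAdj_path_symm hbridge)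
  have hpath : Relation.ReflTransGen (FAdj (↑C : Set (ZdPlaquette 4))) p p' := (toRoot hp).trans (fAdj_path_symm (toRoot hp'))
  obtain ⟨S, hS, hScard⟩ := exists_many_images hL h2C hpath hpp' hπ
  have : (S.image (πP L)).card ≤ (C.image (πP L)).card := card_le_card (image_subset_image fun s hs => hS hs)
  omega

/-! ## §3 Surjectivity: every valid torus polymer is the image of a valid `ℤ⁴` polymer -/

/-- ★ Every valid torus polymer through `torusEdge L f̃` of size `n ≤ 2L − 1` is the image of a valid `ℤ⁴` polymer through `f̃` (`L ≥ 3` even). [folklore] -/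
theorem exists_validZ_preimage [NeZero L] (hL : 3 ≤ L) (hLe : Even L) {f : ZdEdge 4} {n : ℕ} (hn : n + 1 ≤ 2 * L)
    {Y : Finset (TPlaquette L)} (hY : ValidT L (torusEdge L f) n Y) : ∃ X : Finset (ZdPlaquette 4), ValidZ f n X ∧ X.image (πP L) = Y := by
  classical
  obtain ⟨hcard, hroot, hconn, hclosed⟩ := hY
  -- a root plaquette `y₀ ∋ torusEdge f` and its lift `p₀ ∋ f`
  obtain ⟨y₀, hy₀, hfy₀⟩ := mem_biUnion.1 hroot
  rw [torusSystem_edges] at hfy₀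
  obtain ⟨p₀, hp₀, hfp₀⟩ := exists_lift_plaquette hfy₀
  -- free adjacency inside the preimage of `Y`, and the reachable set `C`
  let R : ZdPlaquette 4 → ZdPlaquette 4 → Prop := fun a b =>
    πP L a ∈ Y ∧ πP L b ∈ Y ∧ ∃ e : ZdEdge 4, IsFreeLink e ∧ e ∈ plaquetteEdges a ∧ e ∈ plaquetteEdges b
  let C : Set (ZdPlaquette 4) := {p | Relation.ReflTransGen R p₀ p}
  have hp₀C : p₀ ∈ C := Relation.ReflTransGen.refl
  have hCY : ∀ p ∈ C, πP L p ∈ Y := by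
    intro p hp
    induction hp with
    | refl => rw [hp₀]; exact hy₀
    | tail _ hbc _ => exact hbc.2.1
  -- `C` is free-2-covered
  have h2C : TwoCovered C := by
    intro q hq l hl hfree
    have hlq : torusEdge L l ∈ tEdges (πP L q) := torusEdge_mem_tEdges hl
    have hlY : torusEdge L l ∈ AbstractPolymerKraft.links (torusSystem L) Y := mem_biUnion.2 ⟨πP L q, hCY q hq, by rw [torusSystem_edges]; exact hlq⟩
    have h2 := hclosed _ hlY ((isFreeLinkT_torusEdge_iff hLe l).2 hfree)
    obtain ⟨y', hy', hne⟩ := Finset.exists_mem_ne (lt_of_lt_of_le one_lt_two h2) (πP L q)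
    have hy'Y : y' ∈ Y := (mem_filter.1 hy').1
    have hly' : torusEdge L l ∈ tEdges y' := by have := (mem_filter.1 hy').2; rwa [torusSystem_edges] at this
    obtain ⟨q', hq', hlq'⟩ := exists_lift_plaquette hly'
    refine ⟨q', ?_, fun h => hne (by rw [← hq', h]), hlq'⟩
    exact Relation.ReflTransGen.tail hq ⟨hCY q hq, by rw [hq']; exact hy'Y, l, hfree, hl, hlq'⟩
  -- free-link paths inside `C` from `p₀`
  have hpathC : ∀ p ∈ C, Relation.ReflTransGen (FAdj C) p₀ p := by
    intro p hp
    induction hp with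
    | refl => exact Relation.ReflTransGen.refl
    | @tail b c hab hbc ih =>
      exact ih.tail ⟨hab, Relation.ReflTransGen.tail hab hbc, hbc.2.2⟩
  -- `πP` is injective on `C`
  have hinj : Set.InjOn (πP L) C := by
    intro p hp p' hp' heq
    by_contra hne
    obtain ⟨S, hS, hScard⟩ := exists_many_images hL h2C ((fAdj_path_symm (hpathC p hp)).trans (hpathC p' hp')) hne heq
    have hsub : S.image (πP L) ⊆ Y := fun y hy => by
      obtain ⟨s, hs, rfl⟩ := mem_image.1 hy
      exact hCY s (hS hs)
    have := card_le_card hsub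
    omega
  -- hence `C` is finite
  have hfin : C.Finite := by
    refine Set.Finite.of_finite_image ?_ hinj
    exact (Y.finite_toSet).subset fun y hy => by obtain ⟨p, hp, rfl⟩ := hy; exact hCY p hp
  set X := hfin.toFinset with hX
  have hmemX : ∀ p, p ∈ X ↔ p ∈ C := fun p => Set.Finite.mem_toFinset hfin
  have hinjX : Set.InjOn (πP L) ↑X := fun p hp p' hp' h => hinj ((hmemX p).1 hp) ((hmemX p').1 hp') h
  -- the image of `X` is `Y` (lift free-torus-link paths from `y₀`)
  have hlift : ∀ y, Relation.ReflTransGen (fun a b : TPlaquette L => a ∈ Y ∧ b ∈ Y ∧ ∃ e : TEdge L, IsFreeLinkT e ∧ e ∈ (torusSystem L).edges a ∧ e ∈ (torusSystem L).edges b) y₀ y →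
      ∃ p ∈ C, πP L p = y := by
    intro y hy
    induction hy with
    | refl => exact ⟨p₀, hp₀C, hp₀⟩
    | @tail b c _ hbc ih =>
      obtain ⟨p, hpC, hpb⟩ := ih
      obtain ⟨-, hcY, ē, hē, hēb, hēc⟩ := hbc
      rw [torusSystem_edges] at hēb hēc
      rw [← hpb, tEdges_πP] at hēb
      obtain ⟨l, hlp, rfl⟩ := mem_image.1 hēb
      have hlfree : IsFreeLink l := (isFreeLinkT_torusEdge_iff hLe l).1 hē
      obtain ⟨p', hp', hlp'⟩ := exists_lift_plaquette hēc
      refine ⟨p', Relation.ReflTransGen.tail hpC ⟨hCY p hpC, by rw [hp']; exact hcY, l, hlfree, hlp, hlp'⟩, hp'⟩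
  have himg : X.image (πP L) = Y := by
    ext y
    constructor
    · intro hy
      obtain ⟨p, hp, rfl⟩ := mem_image.1 hy
      exact hCY p ((hmemX p).1 hp)
    · intro hy
      obtain ⟨p, hpC, rfl⟩ := hlift y (hconn y₀ hy₀ y hy)
      exact mem_image_of_mem _ ((hmemX p).2 hpC)
  refine ⟨X, ⟨?_, ?_, ?_, ?_⟩, himg⟩
  · -- card
    have := card_image_of_injOn hinjX
    rw [himg, hcard] at this
    exact this.symm
  · exact mem_biUnion.2 ⟨p₀, (hmemX p₀).2 hp₀C, hfp₀⟩
  · intro p hp q hq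
    have hpq : Relation.ReflTransGen (FAdj C) p q := (fAdj_path_symm (hpathC p ((hmemX p).1 hp))).trans (hpathC q ((hmemX q).1 hq))
    exact reflTransGen_of_imp (fun a b hab => ⟨(hmemX a).2 hab.1, (hmemX b).2 hab.2.1, hab.2.2⟩) hpq
  · intro l hl hfree
    obtain ⟨q, hq, hlq⟩ := mem_biUnion.1 hl
    obtain ⟨q', hq'C, hne, hlq'⟩ := h2C q ((hmemX q).1 hq) l hlq hfree
    exact Finset.one_lt_card.2 ⟨q, mem_filter.2 ⟨hq, hlq⟩, q', mem_filter.2 ⟨(hmemX q').2 hq'C, hlq'⟩, hne.symm⟩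

/-! ## §4 ★ Lemma W: the census identity -/

/-- ★★ **LEMMA W (RADIUS-DERIVATION v0.6.2 (7.0)) — THE TORUS CENSUS IDENTITY.**  For `3 ≤ L`, `L` even, a free link `f̃` of `ℤ⁴` and `n + 1 ≤ 2L`: the number of (G1) polymers of
the torus `(ℤ/L)⁴` with `n` plaquettes through `torusEdge L f̃` equals the number of (G1) polymers of `ℤ⁴` with `n` plaquettes through `f̃`. [folklore] -/
theorem census_identity [NeZero L] (hL : 3 ≤ L) (hLe : Even L) {f : ZdEdge 4} (hf : IsFreeLink f) {n : ℕ} (hn : n + 1 ≤ 2 * L) :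
    freePolymerCountT L (torusEdge L f) n = freePolymerCount f n := by
  classical
  rw [freePolymerCount_eq, freePolymerCountT_eq]
  let Φ : {X : Finset (ZdPlaquette 4) // ValidZ f n X} → {Y : Finset (TPlaquette L) // ValidT L (torusEdge L f) n Y} :=
    fun X => ⟨X.1.image (πP L), validT_image hL hLe hn X.2⟩
  have hΦ : Function.Bijective Φ := by
    constructor
    · intro X₁ X₂ h
      exact Subtype.ext (eq_of_image_eq hL hf hn X₁.2 X₂.2 (congrArg Subtype.val h))
    · intro Y
      obtain ⟨X, hX, himg⟩ := exists_validZ_preimage hL hLe hn Y.2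
      exact ⟨⟨X, hX⟩, Subtype.ext himg⟩
  exact (Nat.card_congr (Equiv.ofBijective Φ hΦ)).symm

/-- Every free torus link is the projection of a free `ℤ⁴` link — its canonical section `torusSect L f̄` (even `L`). [folklore] -/
theorem isFreeLink_torusSect [NeZero L] (hLe : Even L) {f : TEdge L} (hf : IsFreeLinkT f) : IsFreeLink (torusSect L f) := by
  rw [← isFreeLinkT_torusEdge_iff hLe, torusEdge_torusSect]; exact hf

/-- ★ Lemma W at an arbitrary FREE TORUS LINK `f̄`: `N^{T_L}(n; f̄) = N_{ℤ⁴}(n; torusSect L f̄)` for `n + 1 ≤ 2L` (`3 ≤ L`, `L` even). [folklore] -/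
theorem census_identity_torusLink [NeZero L] (hL : 3 ≤ L) (hLe : Even L) {f : TEdge L} (hf : IsFreeLinkT f) {n : ℕ} (hn : n + 1 ≤ 2 * L) :
    freePolymerCountT L f n = freePolymerCount (torusSect L f) n := by
  have h := census_identity hL hLe (isFreeLink_torusSect hLe hf) hn
  rwa [torusEdge_torusSect] at h

/-- The (β-torus) instance: on the window torus `L = 2S₀`, `S₀ ≥ 2`, the census head transfers for every `n ≤ 4S₀ − 1`. [folklore] -/
theorem census_identity_window (S₀ : ℕ) (hS : 2 ≤ S₀) {f : ZdEdge 4} (hf : IsFreeLink f) {n : ℕ} (hn : n + 1 ≤ 4 * S₀) :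
    haveI : NeZero (2 * S₀) := ⟨by omega⟩
    freePolymerCountT (2 * S₀) (torusEdge (2 * S₀) f) n = freePolymerCount f n := by
  haveI : NeZero (2 * S₀) := ⟨by omega⟩
  exact census_identity (by omega) ⟨S₀, by ring⟩ hf (by omega)

end Summit.QuantumFields.YangMills.Theorems.Instrument.TorusCensusIdentity

end
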